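import Mathlib
import Summits.Ventures.PercRepro.MatroidColoopStepA

/-!
# PercRepro — Lemma J, part B: loops double both counts (typer-2, gen 6; split gen 7)

The second half of the gen-6 module `MatroidColoopStep` (split at the section boundary for the 400-line landing lint;
every proof byte-identical): the coloop half (`levelCount`, `topCount`, `Levelwise`, `levelCount_eq_of_isColoop`,
`topCount_eq_of_isColoop`, `levelwise_of_isColoop`, `levelwise_zero_of_isColoop`, …) is `MatroidColoopStepA`; this file
carries the LOOP half — **`levelCount_eq_of_isLoop`**, **`topCount_eq_of_isLoop`**, **`levelwise_iff_of_isLoop`**: a loop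
DOUBLES both counts (`insert e` is a bijection between the sets missing `e` and those containing it, ranks unchanged), so
the level-wise form for `M` is the one for `M ＼ {e}` (mine-2's «loops halve»). Importers of `MatroidColoopStep` see both
halves (the A part is imported here).
-/

open Set
open scoped Matroid   -- before `namespace PercRepro`: inside it `Matroid` would resolve to `PercRepro.Matroid` (declared by the A part)

namespace PercRepro

namespace Matroid

variable {α : Type*} {M : _root_.Matroid α}

/-! ### Loops: both counts double -/

section Loop

variable {e : α} (he : M.IsLoop e)
include he

/-- Adding the loop `e` to a subset of the ground set does not change the rank. -/
theorem eRk_insert_loop {T : Set α} (hT : T ⊆ M.E) : M.eRk (insert e T) = M.eRk T := by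
  refine le_antisymm ?_ (M.eRk_mono (Set.subset_insert e T))
  calc M.eRk (insert e T) ≤ M.eRk (M.closure T) :=
        M.eRk_mono (Set.insert_subset (he.mem_closure T) (M.subset_closure T hT))
    _ = M.eRk T := M.eRk_closure_eq T

/-- The subsets of `M.E` of rank `u` containing the loop `e` are `insert e T` for the subsets `T` of
`M ＼ {e}` of rank `u`. -/
theorem level_mem_eq_of_isLoop (u : ℕ) :
    {S : Set α | S ⊆ M.E ∧ M.eRk S = (u : ℕ∞) ∧ e ∈ S} =
      (fun T => insert e T) '' {T : Set α | T ⊆ (M ＼ {e}).E ∧ (M ＼ {e}).eRk T = (u : ℕ∞)} := by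
  ext S
  simp only [Set.mem_setOf_eq, Set.mem_image, delete_singleton_ground]
  constructor
  · rintro ⟨hS, hr, heS⟩
    have hT : S \ {e} ⊆ M.E := fun x hx => hS hx.1
    have heT : e ∉ S \ {e} := fun h => h.2 rfl
    refine ⟨S \ {e}, ⟨fun x hx => ⟨hS hx.1, hx.2⟩, ?_⟩, ?_⟩
    · rw [eRk_delete_of_notMem hT heT, ← hr, ← eRk_insert_loop he hT, Set.insert_sdiff_singleton,
        Set.insert_eq_of_mem heS]
    · rw [Set.insert_sdiff_singleton, Set.insert_eq_of_mem heS]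
  · rintro ⟨T, ⟨hT, hr⟩, rfl⟩
    have hT' : T ⊆ M.E := fun x hx => (hT hx).1
    have heT : e ∉ T := fun h => (hT h).2 rfl
    refine ⟨Set.insert_subset he.mem_ground hT', ?_, Set.mem_insert _ _⟩
    rw [eRk_insert_loop he hT', ← eRk_delete_of_notMem hT' heT, hr]

omit he in
/-- Injectivity of `insert e` on sets missing `e`. -/
theorem insert_injOn_notMem (P : Set (Set α)) (hP : ∀ T ∈ P, e ∉ T) :
    Set.InjOn (fun T : Set α => insert e T) P := by
  intro T hT T' hT' h
  rw [← Set.insert_sdiff_self_of_notMem (hP T hT), ← Set.insert_sdiff_self_of_notMem (hP T' hT')]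
  exact congrArg (· \ {e}) h

variable [M.Finite]

/-- **`W_u(M) = 2 · W_u(M ＼ {e})`** for a loop `e`. -/
theorem levelCount_eq_of_isLoop (u : ℕ) : levelCount M u = 2 * levelCount (M ＼ {e}) u := by
  classical
  unfold levelCount
  have hfin : {S : Set α | S ⊆ M.E ∧ M.eRk S = (u : ℕ∞)}.Finite :=
    M.ground_finite.finite_subsets.subset fun S hS => hS.1
  have hsplit : {S : Set α | S ⊆ M.E ∧ M.eRk S = (u : ℕ∞)} =
      {S : Set α | S ⊆ M.E ∧ M.eRk S = (u : ℕ∞) ∧ e ∉ S} ∪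
        {S : Set α | S ⊆ M.E ∧ M.eRk S = (u : ℕ∞) ∧ e ∈ S} := by
    ext S
    simp only [Set.mem_setOf_eq, Set.mem_union]
    constructor
    · rintro ⟨h1, h2⟩
      by_cases h : e ∈ S
      · exact Or.inr ⟨h1, h2, h⟩
      · exact Or.inl ⟨h1, h2, h⟩
    · rintro (⟨h1, h2, _⟩ | ⟨h1, h2, _⟩) <;> exact ⟨h1, h2⟩
  have hdisj : Disjoint {S : Set α | S ⊆ M.E ∧ M.eRk S = (u : ℕ∞) ∧ e ∉ S}
      {S : Set α | S ⊆ M.E ∧ M.eRk S = (u : ℕ∞) ∧ e ∈ S} := by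
    rw [Set.disjoint_left]
    rintro S ⟨_, _, h⟩ ⟨_, _, h'⟩
    exact h h'
  have hinj : Set.InjOn (fun T : Set α => insert e T)
      {T : Set α | T ⊆ (M ＼ {e}).E ∧ (M ＼ {e}).eRk T = (u : ℕ∞)} :=
    insert_injOn_notMem _ fun T hT h => (hT.1 h).2 rfl
  rw [hsplit, Set.ncard_union_eq hdisj (hfin.subset (hsplit ▸ Set.subset_union_left))
      (hfin.subset (hsplit ▸ Set.subset_union_right)),
    level_notMem_eq, level_mem_eq_of_isLoop he, hinj.ncard_image, two_mul]

omit [M.Finite] in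
/-- The members of `U_M(p, q)` missing the loop `e` are the members of `U_{M ＼ {e}}(p, q)`. -/
theorem top_notMem_eq_of_isLoop (p q : ℕ) :
    {A : Set α | A ⊆ M.E ∧ M.eRk A = (p : ℕ∞) ∧ M.eRk (M.E \ A) = (q : ℕ∞) ∧ e ∉ A} =
      {A : Set α | A ⊆ (M ＼ {e}).E ∧ (M ＼ {e}).eRk A = (p : ℕ∞) ∧
        (M ＼ {e}).eRk ((M ＼ {e}).E \ A) = (q : ℕ∞)} := by
  ext A
  simp only [Set.mem_setOf_eq, delete_singleton_ground]
  have hc : ∀ {A : Set α}, e ∉ A → M.E \ A = insert e ((M.E \ {e}) \ A) := by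
    intro A heA
    ext x
    simp only [Set.mem_sdiff, Set.mem_insert_iff, Set.mem_singleton_iff]
    constructor
    · rintro ⟨hxE, hxA⟩
      by_cases hx : x = e
      · exact Or.inl hx
      · exact Or.inr ⟨⟨hxE, hx⟩, hxA⟩
    · rintro (rfl | ⟨⟨hxE, _⟩, hxA⟩)
      · exact ⟨he.mem_ground, heA⟩
      · exact ⟨hxE, hxA⟩
  constructor
  · rintro ⟨hA, hr, hr', heA⟩
    refine ⟨fun x hx => ⟨hA hx, fun h => heA (h ▸ hx)⟩, ?_, ?_⟩
    · rw [eRk_delete_of_notMem hA heA, hr]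
    · have heT : e ∉ (M.E \ {e}) \ A := fun h => h.1.2 rfl
      rw [eRk_delete_of_notMem (fun x hx => hx.1.1) heT, ← eRk_insert_loop he (fun x hx => hx.1.1),
        ← hc heA, hr']
  · rintro ⟨hA, hr, hr'⟩
    have hA' : A ⊆ M.E := fun x hx => (hA hx).1
    have heA : e ∉ A := fun h => (hA h).2 rfl
    refine ⟨hA', ?_, ?_, heA⟩
    · rw [← eRk_delete_of_notMem hA' heA, hr]
    · have heT : e ∉ (M.E \ {e}) \ A := fun h => h.1.2 rfl
      rw [hc heA, eRk_insert_loop he (fun x hx => hx.1.1), ← eRk_delete_of_notMem (fun x hx => hx.1.1) heT,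
        hr']

omit [M.Finite] in
/-- The members of `U_M(p, q)` containing the loop `e` are `insert e A` for `A ∈ U_{M ＼ {e}}(p, q)`. -/
theorem top_mem_eq_of_isLoop (p q : ℕ) :
    {A : Set α | A ⊆ M.E ∧ M.eRk A = (p : ℕ∞) ∧ M.eRk (M.E \ A) = (q : ℕ∞) ∧ e ∈ A} =
      (fun T => insert e T) ''
        {A : Set α | A ⊆ (M ＼ {e}).E ∧ (M ＼ {e}).eRk A = (p : ℕ∞) ∧
          (M ＼ {e}).eRk ((M ＼ {e}).E \ A) = (q : ℕ∞)} := by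
  ext S
  simp only [Set.mem_setOf_eq, Set.mem_image, delete_singleton_ground]
  constructor
  · rintro ⟨hS, hr, hr', heS⟩
    have hT : S \ {e} ⊆ M.E := fun x hx => hS hx.1
    have heT : e ∉ S \ {e} := fun h => h.2 rfl
    refine ⟨S \ {e}, ⟨fun x hx => ⟨hS hx.1, hx.2⟩, ?_, ?_⟩, ?_⟩
    · rw [eRk_delete_of_notMem hT heT, ← hr, ← eRk_insert_loop he hT, Set.insert_sdiff_singleton,
        Set.insert_eq_of_mem heS]
    · have hc : (M.E \ {e}) \ (S \ {e}) = M.E \ S := by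
        ext x
        simp only [Set.mem_sdiff, Set.mem_singleton_iff, not_and, not_not]
        constructor
        · rintro ⟨⟨hxE, hxe⟩, h⟩
          exact ⟨hxE, fun hxS => hxe (h hxS)⟩
        · rintro ⟨hxE, hxS⟩
          exact ⟨⟨hxE, fun hxe => hxS (hxe ▸ heS)⟩, fun hxS' => absurd hxS' hxS⟩
      rw [hc, eRk_delete_of_notMem Set.sdiff_subset (fun h => h.2 heS), hr']
    · rw [Set.insert_sdiff_singleton, Set.insert_eq_of_mem heS]
  · rintro ⟨T, ⟨hT, hr, hr'⟩, rfl⟩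
    have hT' : T ⊆ M.E := fun x hx => (hT hx).1
    have heT : e ∉ T := fun h => (hT h).2 rfl
    refine ⟨Set.insert_subset he.mem_ground hT', ?_, ?_, Set.mem_insert _ _⟩
    · rw [eRk_insert_loop he hT', ← eRk_delete_of_notMem hT' heT, hr]
    · have hc : M.E \ insert e T = (M.E \ {e}) \ T := by
        ext x
        simp only [Set.mem_sdiff, Set.mem_insert_iff, Set.mem_singleton_iff, not_or]
        tauto
      rw [hc, ← hr', eRk_delete_of_notMem (fun x hx => hx.1.1) (fun h => h.1.2 rfl)]

/-- **`#U_M(p, q) = 2 · #U_{M ＼ {e}}(p, q)`** for a loop `e`. -/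
theorem topCount_eq_of_isLoop (p q : ℕ) : topCount M p q = 2 * topCount (M ＼ {e}) p q := by
  classical
  unfold topCount
  have hfin : {A : Set α | A ⊆ M.E ∧ M.eRk A = (p : ℕ∞) ∧ M.eRk (M.E \ A) = (q : ℕ∞)}.Finite :=
    M.ground_finite.finite_subsets.subset fun A hA => hA.1
  have hsplit : {A : Set α | A ⊆ M.E ∧ M.eRk A = (p : ℕ∞) ∧ M.eRk (M.E \ A) = (q : ℕ∞)} =
      {A : Set α | A ⊆ M.E ∧ M.eRk A = (p : ℕ∞) ∧ M.eRk (M.E \ A) = (q : ℕ∞) ∧ e ∉ A} ∪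
        {A : Set α | A ⊆ M.E ∧ M.eRk A = (p : ℕ∞) ∧ M.eRk (M.E \ A) = (q : ℕ∞) ∧ e ∈ A} := by
    ext A
    simp only [Set.mem_setOf_eq, Set.mem_union]
    constructor
    · rintro ⟨h1, h2, h3⟩
      by_cases h : e ∈ A
      · exact Or.inr ⟨h1, h2, h3, h⟩
      · exact Or.inl ⟨h1, h2, h3, h⟩
    · rintro (⟨h1, h2, h3, _⟩ | ⟨h1, h2, h3, _⟩) <;> exact ⟨h1, h2, h3⟩
  have hdisj : Disjoint {A : Set α | A ⊆ M.E ∧ M.eRk A = (p : ℕ∞) ∧ M.eRk (M.E \ A) = (q : ℕ∞) ∧ e ∉ A}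
      {A : Set α | A ⊆ M.E ∧ M.eRk A = (p : ℕ∞) ∧ M.eRk (M.E \ A) = (q : ℕ∞) ∧ e ∈ A} := by
    rw [Set.disjoint_left]
    rintro A ⟨_, _, _, h⟩ ⟨_, _, _, h'⟩
    exact h h'
  have hinj : Set.InjOn (fun T : Set α => insert e T)
      {A : Set α | A ⊆ (M ＼ {e}).E ∧ (M ＼ {e}).eRk A = (p : ℕ∞) ∧
        (M ＼ {e}).eRk ((M ＼ {e}).E \ A) = (q : ℕ∞)} :=
    insert_injOn_notMem _ fun T hT h => (hT.1 h).2 rfl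
  rw [hsplit, Set.ncard_union_eq hdisj (hfin.subset (hsplit ▸ Set.subset_union_left))
      (hfin.subset (hsplit ▸ Set.subset_union_right)),
    top_notMem_eq_of_isLoop he, top_mem_eq_of_isLoop he, hinj.ncard_image, two_mul]

/-- **Loops do not matter**: the level-wise form for `M ＼ {e}` (`e` a loop) is the level-wise form for `M`. -/
theorem levelwise_iff_of_isLoop (p q : ℕ) : Levelwise M p q ↔ Levelwise (M ＼ {e}) p q := by
  unfold Levelwise
  refine forall_congr' fun u => ?_
  rw [levelCount_eq_of_isLoop he, topCount_eq_of_isLoop he]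
  constructor
  · intro h
    nlinarith [h]
  · intro h
    nlinarith [h]

end Loop

end Matroid

end PercRepro
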